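import Literature.AlgebraicGeometry.HodgeTheory.CyclicCoverScalingFamily
import Literature.AlgebraicGeometry.HodgeTheory.UniversalHypersurfaceEhresmann
import Literature.AlgebraicGeometry.Motives.MonomialSupportedHypersurfaceSymmetry
import Literature.AlgebraicGeometry.HodgeTheory.CyclicCoverDeckInvariantsTransfer
import HarnessLib

/-!
# Homogeneous coordinates on the scaling family `x₃^p = λ f` and its untwisting over slit regions

Family `hodge`, layer `Literature/AlgebraicGeometry/HodgeTheory`. Second file (after `CyclicCoverScalingFamily`) of
the proof that **the covering transformation of a cyclic cover `X_F : x₃^p = f` is a monodromy transformation of the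
Carlson–Toledo family** `cyclicCoverFamily p` over the affine space `Ũ` of branch forms (Carlson–Toledo 1999 §2:
"`𝐘` is defined on `ℂ^{N+1} − {0}` and has smooth fibers over `Ũ = ℂ^{N+1} − Δ̃`"; the scaling loop
`u ↦ [x₃^p − e^{2πiu} f]` has holonomy `σ_F : x₃ ↦ ζ_p x₃`). Written by the prover seat `hodge-nonav-prover-Ax`
(g7) for crux K1 of `Summits/HodgeConjecture/HodgeConjecture/Theses/CyclicUnitaryPowers.lean`
(stmt-HodgeConjecture-19544), as the discharge of the cited fact
`carlsonToledo1999_monodromyInvariants_eq_deckInvariants` (file `CyclicCoverMeridianMonodromy`).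

* §1 `totalProj`, `baseCoord` — homogeneous coordinates `[x₀:x₁:x₂:x₃]` of a complex point of the total space
  `𝒴_λ` of the scaling family `scalingFamily p f` and the parameter `λ(t)` of a base point (continuous,
  `λ(t) ≠ 0`, the form of `t` is `x₃^p − λ(t) f`); `exists_fiberIsoSpz_comp` — fibres of ANY specialised family
  are identified with the model hypersurfaces compatibly with the embeddings into `ℙⁿ⁺¹`;
  `totalProj_mem_projZeroLocus` — the coordinates of a point over `t` satisfy `x₃^p = λ(t) f(x₀,x₁,x₂)`.
* §2 `unitScale` (`[z] ↦ [a • z]`, jointly continuous in `(a, [z])` through the open quotient map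
  `𝟙 × (v ↦ [v])`), `branchRoot` (continuous branches `c(λ)` of `λ^{-1/p}` on slit regions, with `c(λ)^p = λ⁻¹`
  and the values `c₁(1) = 1`, `c₁(−1) = c₂(−1)`, `c₂(1) = ζ_p⁻¹`), and the **untwisting map** `untwist` of the
  tube of `𝒴_λ` over a slit region: `[x₀:x₁:x₂:x₃] ↦ [x₀:x₁:x₂:c(λ)x₃] ∈ X_F(ℂ)` — continuous
  (`continuous_untwist`), with prescribed coordinates (`hypersurfacePoint_untwist`). This is the topological
  trivialisation `x₃ ↦ λ^{-1/p} x₃` of the scaling family away from a cut.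

Theorems and concrete definitions only; no named fact.

## References

* [CarlsonToledo1999] J. A. Carlson, D. Toledo, Discriminant complements and kernels of monodromy
  representations, Duke Math. J. 97 (1999), §2 (held text `paper:arxiv-alg-geom_9708002` p0004–p0005).
* [VoisinHodgeII2003] C. Voisin, Hodge Theory and Complex Algebraic Geometry II, CUP 2003, §3.1.2, §3.2.1, §6.2.1.
* [SerreGAGA1956] J.-P. Serre, GAGA, Ann. Inst. Fourier 6 (1956), §2 n°5.
* [Hartshorne1977] R. Hartshorne, Algebraic Geometry, II Example 7.1.1.
-/

noncomputable section

namespace Literature.AlgebraicGeometry.HodgeTheory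

open CategoryTheory MvPolynomial
open _root_.Topology
open Literature.AlgebraicGeometry.Motives Literature.AlgebraicGeometry.Motives.UniversalHypersurface
open Literature.AlgebraicGeometry.HodgeTheory.UniversalHypersurface
open Literature.AlgebraicTopology.SingularHomology
open Literature.NumberTheory.Transcendental

open scoped LinearAlgebra.Projectivization

namespace CyclicCoverScaling

/-! ### §1 Homogeneous coordinates on the scaling family -/

section Coordinates

variable {p : ℕ} {f : MvPolynomial (Fin 3) ℂ}

variable (p f) in
/-- The projection `𝒴_λ → 𝒴_U → ℙ³` of the total space of the scaling family. [cite: CarlsonToledo1999, §2 (held text p0004)] -/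
abbrev totalToProjectiveSpace : scalingTotal p f ⟶ Motives.projectiveSpace (2 + 1) ℂ :=
  totalSpzToTotal ℂ 2 p (scalingSpz p f) ≫ UniversalHypersurface.toProjectiveSpace ℂ 2 p

variable (p f) in
/-- Homogeneous coordinates `[x₀:x₁:x₂:x₃]` of a complex point of the total space `𝒴_λ`.
[cite: SerreGAGA1956, §2 n°5] -/
def totalProj (y : ComplexPoints (scalingTotal p f)) : ℙ ℂ (Fin 4 → ℂ) :=
  hypersurfacePoint (totalToProjectiveSpace p f) y

/-- `totalProj` is continuous. [cite: SerreGAGA1956, §2 n°5] -/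
theorem continuous_totalProj : Continuous (totalProj p f) := continuous_hypersurfacePoint _

variable (p f) in
/-- The parameter `λ(t)` of a point `t` of the base `S_λ(ℂ)`. [cite: CarlsonToledo1999, §2 (held text p0004)] -/
def baseCoord (t : ComplexPoints (scalingBase p f)) : ℂ :=
  pointAlgHomSpz ℂ 2 p (scalingSpz p f) t (MvPolynomial.X ())

/-- The coefficient homomorphism of `t` is evaluation at `λ(t)`. [cite: CarlsonToledo1999, §2 (held text p0004)] -/
theorem pointAlgHomSpz_eq_evalAt (t : ComplexPoints (scalingBase p f)) :
    pointAlgHomSpz ℂ 2 p (scalingSpz p f) t = evalAt (baseCoord p f t) :=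
  MvPolynomial.algHom_ext fun u => by cases u; rw [evalAt_X]; rfl

/-- **The form of the point `t` is `x₃^p − λ(t)·f`.** [cite: CarlsonToledo1999, §2 (held text p0004)] -/
theorem pointFormSpz_eq (hp : p ≠ 0) (hf : f.IsHomogeneous p) (t : ComplexPoints (scalingBase p f)) :
    pointFormSpz ℂ 2 p (scalingSpz p f) t = cyclicCoverForm p (baseCoord p f t • f) := by
  refine eq_of_coeffHom_eq (isHomogeneous_pointForm ℂ 2 p _)
    (CyclicCoverFormNonsingular.isHomogeneous_cyclicCoverForm_of_isHomogeneous (isHomogeneous_smul hf _)) ?_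
  rw [← pointAlgHomSpz_comp, pointAlgHomSpz_eq_evalAt, evalAt_comp_scalingSpz p f hp]

/-- `λ` of the point `λ = c` is `c`. [cite: CarlsonToledo1999, §2 (held text p0004)] -/
theorem baseCoord_scalingPoint (hp : 2 ≤ p) (hf : f.IsHomogeneous p)
    (hJ : SmoothHypersurface.IsNonsingularForm ℂ (cyclicCoverForm p f)) (c : ℂ) (hc : c ≠ 0) :
    baseCoord p f (scalingPoint p f hp hf hJ c hc) = c := by
  rw [baseCoord, pointAlgHomSpz_apply, scalingPoint, pointHomSpz_pointOfFormSpz, CommRingCat.hom_ofHom]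
  exact evalAt_X c

/-- `λ(t) ≠ 0`: `x₃^p` alone is singular. [cite: CarlsonToledo1999, §2 (held text p0004)] -/
theorem baseCoord_ne_zero (hp : 2 ≤ p) (hf : f.IsHomogeneous p) (t : ComplexPoints (scalingBase p f)) :
    baseCoord p f t ≠ 0 := by
  intro h0
  have hJ := isNonsingularForm_pointForm ℂ 2 p (AlgPoints.map (toBaseSpz ℂ 2 p (scalingSpz p f)) t)
  change SmoothHypersurface.IsNonsingularForm ℂ (pointFormSpz ℂ 2 p (scalingSpz p f) t) at hJ
  rw [pointFormSpz_eq (by omega) hf, h0, zero_smul] at hJ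
  exact CyclicCoverFormNonsingular.not_isNonsingularForm_cyclicCoverForm_zero hp hJ

/-- **`λ` is continuous on `S_λ(ℂ)`**: `−f_e λ(t)` is a coefficient of the form of `t`, a continuous function
of the image of `t` in `U(ℂ)`. [cite: SerreGAGA1956, §2 n°5] -/
theorem continuous_baseCoord (hp : p ≠ 0) (hf : f.IsHomogeneous p) (hf0 : f ≠ 0) :
    Continuous (baseCoord p f) := by
  obtain ⟨m, hm⟩ := MvPolynomial.ne_zero_iff.mp hf0
  have hdeg : m.degree = p := by
    have h := hf hm
    rw [Finsupp.degree_eq_weight_one]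
    exact h
  set e : TernaryIndex p := ⟨m, hdeg⟩
  -- `coeff_{(e,0)} F_t = −λ(t) f_e`
  have hcoef : ∀ t : ComplexPoints (scalingBase p f),
      coeffVector ℂ 2 p (AlgPoints.map (toBaseSpz ℂ 2 p (scalingSpz p f)) t) (extendIndex e) =
        -(baseCoord p f t * f.coeff m) := fun t => by
    rw [coeffVector_apply]
    change coeff (extendIndex e).1 (pointFormSpz ℂ 2 p (scalingSpz p f) t) = _
    rw [coeff_pointFormSpz, scalingSpz_X_extendIndex p f hp, ← pointAlgHomSpz_apply, map_neg, map_mul,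
      MvPolynomial.algHom_C, Algebra.algebraMap_self_apply, mul_comm]
    rfl
  have hc : Continuous fun t : ComplexPoints (scalingBase p f) =>
      coeffVector ℂ 2 p (AlgPoints.map (toBaseSpz ℂ 2 p (scalingSpz p f)) t) (extendIndex e) := by
    have h1 : Continuous fun t : ComplexPoints (scalingBase p f) =>
        coeffVector ℂ 2 p (AlgPoints.map (toBaseSpz ℂ 2 p (scalingSpz p f)) t) :=
      (continuous_coeffVector ℂ 2 p).comp (AlgPoints.continuous_map (L := ℂ) (toBaseSpz ℂ 2 p (scalingSpz p f)))
    exact (continuous_apply (extendIndex e)).comp h1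
  have heq : baseCoord p f = fun t =>
      -(coeffVector ℂ 2 p (AlgPoints.map (toBaseSpz ℂ 2 p (scalingSpz p f)) t) (extendIndex e)) * (f.coeff m)⁻¹ := by
    funext t
    rw [hcoef, neg_neg, mul_assoc, mul_inv_cancel₀ hm, mul_one]
  rw [heq]
  exact hc.neg.mul continuous_const

/-- **Complex points of fibres of a specialised family embed compatibly in `ℙⁿ⁺¹`**: the fibre `𝒴_{φ,t}` is
isomorphic to the hypersurface `X_{F_t}` of its form by an isomorphism compatible with `𝒴_{φ,t} → 𝒴_φ → 𝒴_U → ℙⁿ⁺¹`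
(the universal fibre's compatible isomorphism `exists_fiberIso_comp_hypersurfaceι`, composed with the base-change
identification `fiberOverFamilyPullbackIso`). [cite: VoisinHodgeII2003, §6.2.1] -/
theorem exists_fiberIsoSpz_comp {n d : ℕ} (hd : 0 < d) {ι : Type} (φ : CoeffRing ℂ n d →ₐ[ℂ] MvPolynomial ι ℂ)
    (t : ComplexPoints (baseSpz ℂ n d φ)) :
    ∃ e : fiberOver (familySpz ℂ n d φ) t ≅ SmoothHypersurface.hypersurface (pointFormSpz ℂ n d φ t),
      e.hom ≫ SmoothHypersurface.hypersurfaceι (pointFormSpz ℂ n d φ t) =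
        fiberι (familySpz ℂ n d φ) t ≫ totalSpzToTotal ℂ n d φ ≫ UniversalHypersurface.toProjectiveSpace ℂ n d := by
  obtain ⟨e₀, he₀⟩ := exists_fiberIso_comp_hypersurfaceι ℂ n d hd (AlgPoints.map (toBaseSpz ℂ n d φ) t)
  refine ⟨fiberOverFamilyPullbackIso (family ℂ n d) (toBaseSpz ℂ n d φ) t ≪≫ e₀, ?_⟩
  have h := fiberOverFamilyPullbackIso_hom_fiberι (family ℂ n d) (toBaseSpz ℂ n d φ) t
  rw [Iso.trans_hom, Category.assoc, he₀, ← Category.assoc]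
  erw [h]
  rfl

/-- Homogeneous coordinates commute with composition of the structure maps. [cite: SerreGAGA1956, §2 n°5] -/
theorem hypersurfacePoint_comp {Y Z : SchemeOver ℂ} (g : Y ⟶ Z) (ι : Z ⟶ Motives.projectiveSpace (2 + 1) ℂ)
    (P : ComplexPoints Y) : hypersurfacePoint (g ≫ ι) P = hypersurfacePoint ι (AlgPoints.map g P) :=
  hypersurfacePoint_eq_of_projPoint_eq _ _ (by rw [projPoint_hypersurfacePoint, AlgPoints.map_comp_apply])

/-- **The homogeneous coordinates of a point of `𝒴_λ` over `t` satisfy `x₃^p = λ(t) f(x₀,x₁,x₂)`.**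
[cite: CarlsonToledo1999, §2 (universalcyclic) (held text p0004)] -/
theorem totalProj_mem_projZeroLocus [NeZero p] (hf : f.IsHomogeneous p) (y : ComplexPoints (scalingTotal p f)) :
    totalProj p f y ∈ Projectivization.projZeroLocus
      {cyclicCoverForm p (baseCoord p f (AlgPoints.map (scalingFamily p f) y) • f)} := by
  -- `y` is a point of the fibre over `t = u(y)`
  generalize ht : AlgPoints.map (scalingFamily p f) y = t
  have hy : y ∈ AlgPoints.map (scalingFamily p f) ⁻¹' {t} := ht
  rw [← AlgPoints.range_map_fiberι] at hy
  obtain ⟨y', rfl⟩ := hy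
  obtain ⟨e, he⟩ := exists_fiberIsoSpz_comp (Nat.pos_of_ne_zero (NeZero.ne p)) (scalingSpz p f) t
  have h1 : totalProj p f (AlgPoints.map (fiberι (scalingFamily p f) t) y') =
      hypersurfacePoint (SmoothHypersurface.hypersurfaceι (pointFormSpz ℂ 2 p (scalingSpz p f) t))
        (AlgPoints.map e.hom y') := by
    rw [totalProj, ← hypersurfacePoint_comp, ← hypersurfacePoint_comp, he]
  rw [h1, ← pointFormSpz_eq (NeZero.ne p) hf t]
  haveI := SmoothHypersurface.isClosedImmersion_hypersurfaceι_left (pointFormSpz ℂ 2 p (scalingSpz p f) t)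
  exact hypersurfacePoint_mem_projZeroLocus (isHomogeneous_pointForm ℂ 2 p _)
    (SmoothHypersurface.range_hypersurfaceι _) _

end Coordinates

end CyclicCoverScaling

end Literature.AlgebraicGeometry.HodgeTheory

namespace Literature.AlgebraicGeometry.HodgeTheory

open CategoryTheory MvPolynomial
open _root_.Topology
open Literature.AlgebraicGeometry.Motives Literature.AlgebraicGeometry.Motives.UniversalHypersurface
open Literature.AlgebraicGeometry.HodgeTheory.UniversalHypersurface
open Literature.AlgebraicTopology.SingularHomology
open Literature.NumberTheory.Transcendental
open scoped LinearAlgebra.Projectivization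

namespace CyclicCoverScaling

/-! ### §2 Scaling the last homogeneous coordinate; branches of `λ^{-1/p}`; the untwisting maps -/

section Untwist

/-- The diagonal unit `(1,1,1,c)`. [cite: Hartshorne1977, II Example 7.1.1] -/
def lastUnit (c : ℂˣ) : Fin 4 → ℂˣ := fun i => if i = Fin.last 3 then c else 1

/-- `(1,1,1,c)_3 = c`. [cite: Hartshorne1977, II Example 7.1.1] -/
@[simp] theorem lastUnit_last (c : ℂˣ) : lastUnit c (Fin.last 3) = c := if_pos rfl

/-- `(1,1,1,c)_i = 1` for `i < 3`. [cite: Hartshorne1977, II Example 7.1.1] -/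
@[simp] theorem lastUnit_castSucc (c : ℂˣ) (j : Fin 3) : lastUnit c (Fin.castSucc j) = 1 :=
  if_neg (Fin.castSucc_lt_last j).ne

/-- `(1,1,1,1) = 1`. [cite: Hartshorne1977, II Example 7.1.1] -/
@[simp] theorem lastUnit_one : lastUnit 1 = 1 := by
  funext i; by_cases h : i = Fin.last 3 <;> simp [lastUnit, h]

/-- **Scaling homogeneous coordinates by a diagonal unit**: `[z] ↦ [a • z]` on `ℙ(ℂ⁴)`.
[cite: Hartshorne1977, II Example 7.1.1] -/
def unitScale (a : Fin 4 → ℂˣ) (q : ℙ ℂ (Fin 4 → ℂ)) : ℙ ℂ (Fin 4 → ℂ) :=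
  Projectivization.mk ℂ (a • q.rep) ((smul_ne_zero_iff_ne a).mpr (Projectivization.rep_nonzero q))

/-- `[a • z] = unitScale a [z]`. [cite: Hartshorne1977, II Example 7.1.1] -/
theorem unitScale_mk (a : Fin 4 → ℂˣ) (v : Fin 4 → ℂ) (hv : v ≠ 0) :
    unitScale a (Projectivization.mk ℂ v hv) =
      Projectivization.mk ℂ (a • v) ((smul_ne_zero_iff_ne a).mpr hv) := by
  rw [unitScale, Projectivization.mk_eq_mk_iff']
  obtain ⟨c, hc⟩ := Projectivization.exists_smul_eq_mk_rep ℂ v hv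
  refine ⟨(c : ℂ), ?_⟩
  rw [← hc, Units.smul_def, smul_comm]

/-- `unitScale 1 = id`. [cite: Hartshorne1977, II Example 7.1.1] -/
@[simp] theorem unitScale_one (q : ℙ ℂ (Fin 4 → ℂ)) : unitScale 1 q = q := by
  rw [unitScale]; simp only [one_smul, Projectivization.mk_rep]

/-- **Joint continuity of `(x, q) ↦ [a(x) • q]`** for a continuous family of diagonal units (test after the open
quotient map `𝟙 × (v ↦ [v])`). [cite: SerreGAGA1956, §2 n°5] -/
theorem continuous_unitScale₂ {X : Type*} [TopologicalSpace X] {a : X → Fin 4 → ℂˣ}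
    (ha : Continuous fun x => fun i => ((a x i : ℂˣ) : ℂ)) {q : X → ℙ ℂ (Fin 4 → ℂ)} (hq : Continuous q) :
    Continuous fun x => unitScale (a x) (q x) := by
  have hΦ : Continuous fun z : X × ℙ ℂ (Fin 4 → ℂ) => unitScale (a z.1) z.2 := by
    have hQ : IsOpenQuotientMap
        (Prod.map (@id X) fun v : {v : Fin 4 → ℂ // v ≠ 0} => Projectivization.mk ℂ v.1 v.2) :=
      IsOpenQuotientMap.id.prodMap Projectivization.isOpenQuotientMap_mk
    rw [hQ.isQuotientMap.continuous_iff]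
    have h0 : ∀ z : X × {v : Fin 4 → ℂ // v ≠ 0}, a z.1 • z.2.1 ≠ 0 := fun z =>
      (smul_ne_zero_iff_ne _).mpr z.2.2
    have heq : ((fun z : X × ℙ ℂ (Fin 4 → ℂ) => unitScale (a z.1) z.2) ∘
        Prod.map (@id X) fun v : {v : Fin 4 → ℂ // v ≠ 0} => Projectivization.mk ℂ v.1 v.2) =
        fun z => Projectivization.mk ℂ (a z.1 • z.2.1) (h0 z) := by
      funext z
      exact unitScale_mk _ _ _
    rw [heq]
    have hc : Continuous fun z : X × {v : Fin 4 → ℂ // v ≠ 0} => a z.1 • z.2.1 := by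
      refine continuous_pi fun i => ?_
      simp only [smul_apply_eq_mul]
      exact ((continuous_apply i).comp (ha.comp continuous_fst)).mul
        ((continuous_apply i).comp (continuous_subtype_val.comp continuous_snd))
    exact Projectivization.continuous_mk.comp (hc.subtype_mk h0)
  exact hΦ.comp (continuous_id.prodMk hq)

/-- **A branch of `λ ↦ λ^{-1/p}`**: `c_{ε,θ}(λ) = exp(−(log(ελ) + θ i)/p)` on `{λ | ελ ∈ slit plane}`, for a unit
`ε` with `e^{θ i} ε = 1` (so that `exp(log(ελ) + θi) = λ`). Used with `(ε, θ) = (−i, π/2)` (branch on the complement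
of the negative imaginary axis, `c(1) = 1`) and `(i, 3π/2)` (complement of the positive imaginary axis, `c(1) = ζ_p⁻¹`),
which agree at `λ = −1`. [cite: VoisinHodgeII2003, §3.2.1] -/
def branchRoot (p : ℕ) (ε : ℂ) (θ : ℝ) (l : ℂ) : ℂ :=
  Complex.exp (-(Complex.log (ε * l) + (θ : ℂ) * Complex.I) / (p : ℂ))

/-- `c(λ) ≠ 0`. [cite: VoisinHodgeII2003, §3.2.1] -/
theorem branchRoot_ne_zero (p : ℕ) (ε : ℂ) (θ : ℝ) (l : ℂ) : branchRoot p ε θ l ≠ 0 := Complex.exp_ne_zero _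

/-- **`c(λ)^p = λ⁻¹`** (for `p ≠ 0`, `ελ ≠ 0`, `e^{θi} ε = 1`). [cite: VoisinHodgeII2003, §3.2.1] -/
theorem branchRoot_pow (p : ℕ) (hp : p ≠ 0) {ε : ℂ} {θ : ℝ} (hε : Complex.exp ((θ : ℂ) * Complex.I) * ε = 1)
    {l : ℂ} (hl : ε * l ≠ 0) : branchRoot p ε θ l ^ p = l⁻¹ := by
  rw [branchRoot, ← Complex.exp_nat_mul, mul_div_cancel₀ _ (Nat.cast_ne_zero.mpr hp), Complex.exp_neg,
    Complex.exp_add, Complex.exp_log hl]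
  congr 1
  calc ε * l * Complex.exp ((θ : ℂ) * Complex.I) = (Complex.exp ((θ : ℂ) * Complex.I) * ε) * l := by ring
    _ = l := by rw [hε, one_mul]

/-- `c` is continuous on `{λ | ελ ∈ slit plane}`. [cite: VoisinHodgeII2003, §3.2.1] -/
theorem continuousOn_branchRoot (p : ℕ) (ε : ℂ) (θ : ℝ) :
    ContinuousOn (branchRoot p ε θ) {l | ε * l ∈ Complex.slitPlane} := by
  intro l hl
  refine (Complex.continuous_exp.continuousAt.comp ?_).continuousWithinAt
  refine ContinuousAt.div_const (ContinuousAt.neg (ContinuousAt.add ?_ continuousAt_const)) _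
  exact (continuousAt_clog hl).comp (continuousAt_const.mul continuousAt_id)

/-- The first branch: `ε = −i`, `θ = π/2`; `e^{πi/2}(−i) = 1`. [cite: VoisinHodgeII2003, §3.2.1] -/
theorem exp_mul_neg_I : Complex.exp (((Real.pi / 2 : ℝ) : ℂ) * Complex.I) * (-Complex.I) = 1 := by
  rw [show (((Real.pi / 2 : ℝ) : ℂ) * Complex.I) = (Real.pi / 2 : ℂ) * Complex.I by push_cast; ring,
    Complex.exp_pi_div_two_mul_I]
  rw [mul_neg, Complex.I_mul_I, neg_neg]

/-- The second branch: `ε = i`, `θ = 3π/2`; `e^{3πi/2} i = 1`. [cite: VoisinHodgeII2003, §3.2.1] -/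
theorem exp_mul_I : Complex.exp (((3 * Real.pi / 2 : ℝ) : ℂ) * Complex.I) * Complex.I = 1 := by
  have h : (((3 * Real.pi / 2 : ℝ) : ℂ) * Complex.I) = (Real.pi / 2 : ℂ) * Complex.I + Real.pi * Complex.I := by
    push_cast; ring
  rw [h, Complex.exp_add, Complex.exp_pi_div_two_mul_I, Complex.exp_pi_mul_I]
  rw [mul_neg, mul_one, neg_mul, Complex.I_mul_I, neg_neg]

/-- `c₁(1) = 1`. [cite: VoisinHodgeII2003, §3.2.1] -/
theorem branchRoot_one_fst (p : ℕ) : branchRoot p (-Complex.I) (Real.pi / 2) 1 = 1 := by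
  rw [branchRoot, mul_one, Complex.log_neg_I]
  have : -(-(Real.pi / 2 : ℂ) * Complex.I + ((Real.pi / 2 : ℝ) : ℂ) * Complex.I) / (p : ℂ) = 0 := by
    push_cast; ring
  rw [show -( -(↑Real.pi / 2) * Complex.I + ((Real.pi / 2 : ℝ) : ℂ) * Complex.I) / (p : ℂ) = 0 from this,
    Complex.exp_zero]

/-- `c₁(−1) = c₂(−1)` (both `= e^{−πi/p}`). [cite: VoisinHodgeII2003, §3.2.1] -/
theorem branchRoot_neg_one (p : ℕ) :
    branchRoot p (-Complex.I) (Real.pi / 2) (-1) = branchRoot p Complex.I (3 * Real.pi / 2) (-1) := by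
  rw [branchRoot, branchRoot, mul_neg_one, neg_neg, Complex.log_I, mul_neg_one, Complex.log_neg_I]
  congr 2
  push_cast
  ring

/-- `c₂(1) = ζ_p⁻¹ = e^{−2πi/p}`. [cite: VoisinHodgeII2003, §3.2.1] -/
theorem branchRoot_one_snd (p : ℕ) :
    branchRoot p Complex.I (3 * Real.pi / 2) 1 = Complex.exp (-(2 * (Real.pi : ℂ) * Complex.I / (p : ℂ))) := by
  rw [branchRoot, mul_one, Complex.log_I]
  congr 1
  push_cast
  ring

/-- `ζ_p⁻¹ = e^{−2πi/p}` is the last entry of `(deckUnit p)⁻¹`. [cite: CarlsonToledo1999, §5 (held text p0011)] -/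
theorem val_deckUnit_inv_last (p : ℕ) :
    (((deckUnit p)⁻¹ (Fin.last 3) : ℂˣ) : ℂ) = Complex.exp (-(2 * (Real.pi : ℂ) * Complex.I / (p : ℂ))) := by
  rw [Pi.inv_apply, deckUnit_def]
  simp only [if_true, Units.val_inv_eq_inv_val, Units.val_mk0, Complex.exp_neg]

/-- `(deckUnit p)⁻¹ = (1,1,1,ζ_p⁻¹) = lastUnit`. [cite: CarlsonToledo1999, §5 (held text p0011)] -/
theorem deckUnit_inv_eq_lastUnit (p : ℕ) :
    (deckUnit p)⁻¹ = lastUnit (Units.mk0 (Complex.exp (-(2 * (Real.pi : ℂ) * Complex.I / (p : ℂ))))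
      (Complex.exp_ne_zero _)) := by
  funext i
  ext
  by_cases h : i = Fin.last 3
  · subst h; rw [val_deckUnit_inv_last, lastUnit_last, Units.val_mk0]
  · rw [Pi.inv_apply, deckUnit_def, lastUnit]
    simp only [h, if_false, inv_one]

variable {p : ℕ} [NeZero p] {f : MvPolynomial (Fin 3) ℂ}

/-- **Scaling `x₃` by `c` with `c^p = λ⁻¹` carries the zeros of `x₃^p − λ f` to the zeros of `x₃^p − f`.**
[cite: CarlsonToledo1999, §2 (universalcyclic) (held text p0004)] -/
theorem unitScale_mem_projZeroLocus (hf : f.IsHomogeneous p) {l : ℂ} (hl : l ≠ 0) {c : ℂˣ}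
    (hc : (c : ℂ) ^ p = l⁻¹) {q : ℙ ℂ (Fin 4 → ℂ)}
    (hq : q ∈ Projectivization.projZeroLocus {cyclicCoverForm p (l • f)}) :
    unitScale (lastUnit c) q ∈ Projectivization.projZeroLocus {cyclicCoverForm p f} := by
  have hq' : MvPolynomial.eval q.rep (cyclicCoverForm p (l • f)) = 0 := hq _ rfl
  rw [eval_cyclicCoverForm_eq, MvPolynomial.smul_eval] at hq'
  have hF : (cyclicCoverForm p f).IsHomogeneous p :=
    CyclicCoverFormNonsingular.isHomogeneous_cyclicCoverForm_of_isHomogeneous hf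
  have hF0 : cyclicCoverForm p f ≠ 0 := by
    intro h0
    have := congrArg (MvPolynomial.coeff (Finsupp.single (Fin.last 3) p)) h0
    rw [coeff_cyclicCoverForm p, MvPolynomial.coeff_zero, if_pos rfl, if_neg (by
      rw [Finsupp.single_eq_same]; exact NeZero.ne p)] at this
    norm_num at this
  have hS : ∀ G ∈ ({cyclicCoverForm p f} : Set (MvPolynomial (Fin 4) ℂ)), G.IsHomogeneous G.totalDegree := by
    rintro G rfl
    rw [hF.totalDegree hF0]
    exact hF
  rw [unitScale, Projectivization.mem_projZeroLocus_mk_iff hS]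
  rintro G rfl
  rw [eval_cyclicCoverForm_eq, smul_apply_eq_mul, lastUnit_last, mul_pow, hc]
  have hinit : Fin.init (lastUnit c • q.rep) = Fin.init q.rep := by
    funext j
    simp only [Fin.init, smul_apply_eq_mul, lastUnit_castSucc, Units.val_one, one_mul]
  rw [hinit]
  have : l⁻¹ * q.rep (Fin.last 3) ^ p - MvPolynomial.eval (Fin.init q.rep) f =
      l⁻¹ * (q.rep (Fin.last 3) ^ p - l * MvPolynomial.eval (Fin.init q.rep) f) := by
    rw [mul_sub, ← mul_assoc, inv_mul_cancel₀ hl, one_mul]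
  rw [this, hq', mul_zero]

variable (p f) in
/-- The complex points of the model `X_F` are the projective zeros of `F`, homeomorphically (the embedding
`hypersurfacePoint`). [cite: SerreGAGA1956, §2 n°5] -/
def modelHomeomorph : ComplexPoints (SmoothHypersurface.hypersurface (cyclicCoverForm p f)) ≃ₜ
    Set.range (hypersurfacePoint (SmoothHypersurface.hypersurfaceι (cyclicCoverForm p f))) :=
  haveI := SmoothHypersurface.isClosedImmersion_hypersurfaceι_left (cyclicCoverForm p f)
  (isEmbedding_hypersurfacePoint (SmoothHypersurface.hypersurfaceι (cyclicCoverForm p f))).toHomeomorph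

omit [NeZero p] in
/-- The range of the coordinates of `X_F` is `V(F)`. [cite: SerreGAGA1956, §2 n°5] -/
theorem range_modelPoint (hf : f.IsHomogeneous p) :
    Set.range (hypersurfacePoint (SmoothHypersurface.hypersurfaceι (cyclicCoverForm p f))) =
      Projectivization.projZeroLocus {cyclicCoverForm p f} :=
  haveI := SmoothHypersurface.isClosedImmersion_hypersurfaceι_left (cyclicCoverForm p f)
  range_hypersurfacePoint (CyclicCoverFormNonsingular.isHomogeneous_cyclicCoverForm_of_isHomogeneous hf)
    (SmoothHypersurface.range_hypersurfaceι _)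

/-- The untwisted point's coordinates lie on `X_F`. [cite: CarlsonToledo1999, §2 (universalcyclic) (held text p0004)] -/
theorem untwist_mem (hf : f.IsHomogeneous p) (ε : ℂ) (θ : ℝ) (hε : Complex.exp ((θ : ℂ) * Complex.I) * ε = 1)
    (y : tubeOver (scalingFamily p f) {t | ε * baseCoord p f t ∈ Complex.slitPlane}) :
    unitScale (lastUnit (Units.mk0 (branchRoot p ε θ (baseCoord p f (AlgPoints.map (scalingFamily p f) y.1)))
        (branchRoot_ne_zero _ _ _ _))) (totalProj p f y.1) ∈
      Set.range (hypersurfacePoint (SmoothHypersurface.hypersurfaceι (cyclicCoverForm p f))) := by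
  rw [range_modelPoint hf]
  have hl : ε * baseCoord p f (AlgPoints.map (scalingFamily p f) y.1) ≠ 0 :=
    Complex.slitPlane_ne_zero y.2
  refine unitScale_mem_projZeroLocus hf (right_ne_zero_of_mul hl) ?_ (totalProj_mem_projZeroLocus hf y.1)
  rw [Units.val_mk0]
  exact branchRoot_pow p (NeZero.ne p) hε hl

/-- **The untwisting map of the tube over `B = {t : ε λ(t) ∈ slit plane}`**: a point `y` of `𝒴_λ` over `t` with
coordinates `[x₀:x₁:x₂:x₃]` goes to the point `[x₀:x₁:x₂:c(λ(t)) x₃]` of `X_F`, `c = branchRoot` the chosen branch of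
`λ^{-1/p}` — the topological trivialisation `x₃ ↦ λ^{-1/p} x₃` of the scaling family over a slit region.
[cite: CarlsonToledo1999, §2 (universalcyclic) (held text p0004)] -/
def untwist (hf : f.IsHomogeneous p) (ε : ℂ) (θ : ℝ) (hε : Complex.exp ((θ : ℂ) * Complex.I) * ε = 1)
    (y : tubeOver (scalingFamily p f) {t | ε * baseCoord p f t ∈ Complex.slitPlane}) :
    ComplexPoints (SmoothHypersurface.hypersurface (cyclicCoverForm p f)) :=
  (modelHomeomorph p f).symm ⟨_, untwist_mem hf ε θ hε y⟩

/-- **Coordinates of the untwisted point**: `[x₀:x₁:x₂:c(λ) x₃]`. [cite: CarlsonToledo1999, §2 (held text p0004)] -/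
theorem hypersurfacePoint_untwist (hf : f.IsHomogeneous p) (ε : ℂ) (θ : ℝ)
    (hε : Complex.exp ((θ : ℂ) * Complex.I) * ε = 1)
    (y : tubeOver (scalingFamily p f) {t | ε * baseCoord p f t ∈ Complex.slitPlane}) :
    hypersurfacePoint (SmoothHypersurface.hypersurfaceι (cyclicCoverForm p f)) (untwist hf ε θ hε y) =
      unitScale (lastUnit (Units.mk0 (branchRoot p ε θ (baseCoord p f (AlgPoints.map (scalingFamily p f) y.1)))
        (branchRoot_ne_zero _ _ _ _))) (totalProj p f y.1) := by
  have h := congrArg Subtype.val ((modelHomeomorph p f).apply_symm_apply ⟨_, untwist_mem hf ε θ hε y⟩)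
  rw [modelHomeomorph, IsEmbedding.toHomeomorph_apply_coe] at h
  exact h

/-- **The untwisting map is continuous.** [cite: SerreGAGA1956, §2 n°5] -/
theorem continuous_untwist (hf : f.IsHomogeneous p) (hf0 : f ≠ 0) (ε : ℂ) (θ : ℝ)
    (hε : Complex.exp ((θ : ℂ) * Complex.I) * ε = 1) : Continuous (untwist hf ε θ hε) := by
  refine (modelHomeomorph p f).symm.continuous.comp (Continuous.subtype_mk ?_ _)
  refine continuous_unitScale₂ ?_ (continuous_totalProj.comp continuous_subtype_val)
  -- the scaling factor is continuous on the tube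
  have hΛ : Continuous fun y : tubeOver (scalingFamily p f) {t | ε * baseCoord p f t ∈ Complex.slitPlane} =>
      baseCoord p f (AlgPoints.map (scalingFamily p f) y.1) :=
    (continuous_baseCoord (NeZero.ne p) hf hf0).comp ((AlgPoints.continuous_map _).comp continuous_subtype_val)
  have hc : Continuous fun y : tubeOver (scalingFamily p f) {t | ε * baseCoord p f t ∈ Complex.slitPlane} =>
      branchRoot p ε θ (baseCoord p f (AlgPoints.map (scalingFamily p f) y.1)) :=
    (continuousOn_branchRoot p ε θ).comp_continuous hΛ fun y => y.2
  refine continuous_pi fun i => ?_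
  by_cases hi : i = Fin.last 3
  · subst hi
    simp only [lastUnit_last, Units.val_mk0]
    exact hc
  · simp only [lastUnit, hi, if_false, Units.val_one]
    exact continuous_const

end Untwist

end CyclicCoverScaling

end Literature.AlgebraicGeometry.HodgeTheory


end
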